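import Summits.QuantumFields.BalabanUV.Beta.GAN24.BornBorderUndressedRowAn1
import Summits.QuantumFields.BalabanUV.Beta.GAN24.S3DiffVSymAn1At
import Summits.QuantumFields.BalabanUV.Beta.GAN24.TopBorderKSlotSymAn1At

/-!
# THE RAW UNDRESSED TOP-ALIGNED V PAIR LETTER (births `≥ 1`, sup currency) FOR an1's SYMMETRISED BORDER TABLE, FROM ROAD S3's DIFF ROWS `S3DiffVSymAn1At.diffV_three_at` ∕
# `TopBorderKSlotSymAn1At.diffVt_three_at` through M.88's exponent identities `BornBorderUndressedRowAn1.lineage_v_succ_pin_apply ∕ lineage_v_top_pin_apply` —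
# **`exists_pairU_v_sup_three`**, UNCONDITIONAL at `d = 3`, `2 ≤ Lc`, pin `cE = Lc^4`, every `cVH`, every in-block root (An1 twin of leaf-04 g57's `BornBorderUndressedDrift`;
# read on the record's `tabs.V = symVhSAt (toSite rr)` by the comb END `CombBornBorderDriftAssembly.exists_pairU_v_raw_sup_three`)

NOT IN PRINT — OUR BOOKKEEPING (road-P2 = `b2b-balaban-gan24-p2` gen 56, 2026-08-25; row G-an2-4 ∕ (CONV-C), the (α-0) chain at row D1's literal
OF RECORD (III′) `JsB12CombShSym`; [folklore] composition BY NAME; 0 `def`, 0 cite, 0 `def … : Prop`, 0 `sorry`).  Weight 0.  NEVER «G-an2-4 closed» as (CONV-C);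
NOT D1, NOT BetaPertH, NOT continuum, NOT Clay; NO campaign opened (an2 W-4) — typed while idle under R-2 as a brick of the located «SYM-S3-V-DIFF» transfer
(the RAW UNDRESSED top-aligned V PAIR letter of the (III′) V-born RATE half `hBd-V`, road-P2 MEMO M-gan24p2-g56-1, `gen56/S-CAMPAIGN-SIZING-g56.v0_7.md` §2(d)).

NAMING: in the existing (E) files «Sym» (`…SymAt`) = the UN-NEGATED rooted border `vhSAt ρ` (the OWNER's W15); «An1» (this file) = an1's (0.4)-SYMMETRISED border
`SymAveragingHessianCounts.symVhSAt ρ` — the type of the record field `SymTables.V`.  METHOD = road-P2's `tools/mkstab.py` (the OWNER gan24-p1's gen-6 `mkroot.py`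
rule): the (E) «Sym» file VERBATIM with `vhSAt (toSite r) d Lc ↦ symVhSAt (toSite r) d Lc` — the symmetrised border has the SAME support ∕ entry ∕ locality letters
(`symVhKerAt_eq_zero_left ∕ _right`, `abs_symVhKerAt_le ≤ 3ℓ²`, `locStencil_symVhSAt`) and the SAME `rfl`-zero ff ∕ mm blocks (accessors `TaylorMassVHAn1At.symVhSAt_inl_inl ∕
_inr_inr`, M.78); every table-free lemma of the base modules is used BY NAME (not re-declared); same theorem names in this file's namespace; base and «Sym» modules
untouched; no zero-root sanity `example`.  Discharges NOTHING of (hS, hSall), the K-slot, hBdev or BetaPertH by itself.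

## Contents (`d = 3`)
END **`exists_pairU_v_sup_three (hLc : 2 ≤ Lc) (hcE : cE = Lc^4) (cVH) : ∃ CU Θ, 0 ≤ CU ∧ 0 < Θ ∧ Θ < 1 ∧ ∀ rr ∈ box (3+1) Lc, ∀ k i, 1 ≤ i → i < k → ∀ κ u,
SupBound (U⁰_{i+1,k+1} − U⁰_{i,k}) (CU·Θ^k)`** for the RAW undressed lineages `U⁰_{i,k} = (cE·Lc^8)^{k−i} • push₃ B_{i+1,k}³ Y⁰_i` on `cVH • symVhSAt (toSite rr) 3 Lc rfl`
(`Lc^4 ×` the two DIFF rows; `Θ = max (max θV θVt) ½`).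
-/

noncomputable section

open Finset
open scoped BigOperators
open Literature.MathematicalPhysics.QuantumFieldTheory
open Literature.MathematicalPhysics.QuantumFieldTheory.Balaban1983to89
open Literature.MathematicalPhysics.QuantumFieldTheory.Balaban1983to89.Beta
open ExpKernelCalculus (MKer)
open OneStepResolventKernel (Fib LocStencil KInv)
open AffineAveraging (box toSite)
open Summit.QuantumFields.BalabanUV.Beta.SymAveragingHessianCounts (symVhSAt symVhKerAt symVhKerAt_eq_zero_left symVhKerAt_eq_zero_right abs_symVhKerAt_le
  locStencil_symVhSAt symVhSAt_symm)
open BalabanCompositeJets (respStep pushSum)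
open DecLiftAdjoint (borderSum)
open Summit.QuantumFields.BalabanUV.Beta.GAN24.CombesThomas (SupBound KStepUnit)
open Summit.QuantumFields.BalabanUV.Beta.GAN24.E3UnitSplit (e3OfS)
open Summit.QuantumFields.BalabanUV.Beta.GAN24.Push3 (push₃)
open Summit.QuantumFields.BalabanUV.Beta.GAN24.SrecLinearPartEq (colM rowMM reslot)
open Summit.QuantumFields.BalabanUV.Beta.GAN24.BornBorderUndressedRowAn1 (lineage_v_succ_pin_apply lineage_v_top_pin_apply)
open Summit.QuantumFields.BalabanUV.Beta.GAN24.S3DiffVSymAn1At (diffV_three_at)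
open Summit.QuantumFields.BalabanUV.Beta.GAN24.TopBorderKSlotSymAn1At (diffVt_three_at)

namespace Summit.QuantumFields.BalabanUV.Beta.GAN24.BornBorderUndressedDriftAn1

variable {Lc : ℕ} [NeZero Lc]

/-- NOT IN PRINT; OUR BOOKKEEPING (`d = 3`, `2 ≤ Lc`, pin `cE = Lc^4`, UNCONDITIONAL; [folklore] assembly BY NAME).  **THE UNDRESSED TOP-ALIGNED V PAIR LETTER, BIRTHS
`≥ 1`, SUP CURRENCY**: for EVERY in-block root, every birth `i ≥ 1` and every `k > i`, the weighted UNDRESSED V lineage of member `k+1` born at `i+1` minus that of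
member `k` born at `i` is `≤ CU·Θ^k` entrywise (ONE `CU ≥ 0`, ONE `0 < Θ < 1`) — by the owner's exponent identities the pair IS `Lc^4 ×` road S3's rooted
symmetric-table DIFF rows: `S3DiffVSymAn1At.diffV_three_at` at `(n, m) = (k−2, i−1)` for lengths `k − i ≥ 2` (its `ρ^{n−m}` dropped), `TopBorderKSlotSymAn1At.diffVt_three_at`
at `n = i−1` for length `1`.  The CONTACT V pairs are NOT here; discharges NOTHING of hBdev by itself; NEVER «G-an2-4 closed». -/
theorem exists_pairU_v_sup_three (hLc : 2 ≤ Lc) {cE : ℝ} (hcE : cE = (Lc : ℝ) ^ (3 + 1)) (cVH : ℝ) :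
    ∃ CU Θ : ℝ, 0 ≤ CU ∧ 0 < Θ ∧ Θ < 1 ∧ ∀ (rr : Fin (3 + 1) → ℕ), rr ∈ box (3 + 1) Lc → ∀ k i : ℕ, 1 ≤ i → i < k → ∀ κ u,
      SupBound
        (((fun κ' u' => (cE * (Lc : ℝ) ^ (2 * (3 + 1))) ^ (k - i) •
            push₃ (respStep (d := 3) (Lc ^ (i + 1 + 1)) (Lc ^ (k + 1))) (respStep (d := 3) (Lc ^ (i + 1 + 1)) (Lc ^ (k + 1)))
              (respStep (d := 3) (Lc ^ (i + 1 + 1)) (Lc ^ (k + 1)))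
              (fun κ u => -(push₃ (-respStep (d := 3) (Lc ^ (i + 1)) (Lc ^ (i + 1 + 1))) (colM (KStepUnit (d := 3) Lc (i + 1)) Lc)
                    (respStep (d := 3) (Lc ^ (i + 1)) (Lc ^ (i + 1 + 1))) (reslot Sum.inl Sum.inr fun κ u => cVH • symVhSAt (toSite rr) 3 Lc rfl κ u) κ u
                + push₃ (rowMM (KStepUnit (d := 3) Lc (i + 1)) Lc) (respStep (d := 3) (Lc ^ (i + 1)) (Lc ^ (i + 1 + 1)))
                    (respStep (d := 3) (Lc ^ (i + 1)) (Lc ^ (i + 1 + 1))) (reslot Sum.inr Sum.inl fun κ u => cVH • symVhSAt (toSite rr) 3 Lc rfl κ u) κ u))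
              κ' u')
          - fun κ' u' => (cE * (Lc : ℝ) ^ (2 * (3 + 1))) ^ (k - i) •
            push₃ (respStep (d := 3) (Lc ^ (i + 1)) (Lc ^ k)) (respStep (d := 3) (Lc ^ (i + 1)) (Lc ^ k)) (respStep (d := 3) (Lc ^ (i + 1)) (Lc ^ k))
              (fun κ u => -(push₃ (-respStep (d := 3) (Lc ^ i) (Lc ^ (i + 1))) (colM (KStepUnit (d := 3) Lc i) Lc)
                    (respStep (d := 3) (Lc ^ i) (Lc ^ (i + 1))) (reslot Sum.inl Sum.inr fun κ u => cVH • symVhSAt (toSite rr) 3 Lc rfl κ u) κ u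
                + push₃ (rowMM (KStepUnit (d := 3) Lc i) Lc) (respStep (d := 3) (Lc ^ i) (Lc ^ (i + 1)))
                    (respStep (d := 3) (Lc ^ i) (Lc ^ (i + 1))) (reslot Sum.inr Sum.inl fun κ u => cVH • symVhSAt (toSite rr) 3 Lc rfl κ u) κ u))
              κ' u') κ u)
        (CU * Θ ^ k) := by
  have hLc1 : 1 ≤ Lc := le_trans (by norm_num) hLc
  have hL0 : (0 : ℝ) ≤ (Lc : ℝ) := Nat.cast_nonneg Lc
  obtain ⟨cV, θ₁, ρ, hcV, hθ₁0, hθ₁1, hρ0, hρ1, hdV⟩ := diffV_three_at (Lc := Lc) hLc cVH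
  obtain ⟨cVt, θ₂, hθ₂0, hθ₂1, hdVt⟩ := diffVt_three_at (Lc := Lc) hLc cVH
  set Θ : ℝ := max (max θ₁ θ₂) (1 / 2) with hΘ
  have hΘ0 : 0 < Θ := lt_of_lt_of_le (by norm_num) (le_max_right _ _)
  have hΘ1 : Θ < 1 := max_lt (max_lt hθ₁1 hθ₂1) (by norm_num)
  have hθ₁Θ : θ₁ ≤ Θ := (le_max_left _ _).trans (le_max_left _ _)
  have hθ₂Θ : θ₂ ≤ Θ := (le_max_right _ _).trans (le_max_left _ _)
  set A : ℝ := (Lc : ℝ) ^ (3 + 1) * (cV + max cVt 0) with hA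
  have hA0 : 0 ≤ A := by positivity
  have hkey : ∀ m : ℕ, A / Θ * Θ ^ (m + 1) = A * Θ ^ m := by
    intro m
    rw [pow_succ]
    field_simp
  refine ⟨A / Θ, Θ, div_nonneg hA0 hΘ0.le, hΘ0, hΘ1, fun rr hrr k i hi hik κ u x z a b => ?_⟩
  rw [Pi.sub_apply, Pi.sub_apply, Pi.sub_apply, Pi.sub_apply, Pi.sub_apply, Pi.sub_apply]
  obtain ⟨j, rfl⟩ : ∃ j, i = j + 1 := ⟨i - 1, by omega⟩
  rcases Nat.lt_or_ge (j + 1 + 1) k with hlt | hge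
  · -- lengths ≥ 2: `k = j + 1 + (n + 1) + 1`, both members by `lineage_v_succ_pin_apply`, the pair = `Lc^4 ×` the rooted row dV at `(j+n+1, j)`
    obtain ⟨n, rfl⟩ : ∃ n, k = j + 1 + (n + 1) + 1 := ⟨k - j - 3, by omega⟩
    rw [show j + 1 + (n + 1) + 1 - (j + 1) = n + 1 + 1 by omega, show j + 1 + (n + 1) + 1 + 1 = j + 1 + 1 + (n + 1) + 1 by omega,
      lineage_v_succ_pin_apply hLc1 hrr hcE cVH (j + 1) n κ u x z a b, lineage_v_succ_pin_apply hLc1 hrr hcE cVH j n κ u x z a b, ← mul_sub,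
      abs_mul, abs_of_nonneg (by positivity : (0 : ℝ) ≤ (Lc : ℝ) ^ (3 + 1))]
    have hd := hdV rr hrr (j + n + 1) j (by omega) κ u x z a b
    rw [show j + n + 1 - j = n + 1 by omega, show j + n + 1 + 1 + 1 + 1 = j + 1 + (n + 1) + 1 + 1 by omega,
      show j + n + 1 + 1 + 1 = j + (n + 1) + 1 + 1 by omega] at hd
    rw [show j + 1 + (n + 1) - (j + 1) = n + 1 by omega, show j + (n + 1) - j = n + 1 by omega]
    refine (mul_le_mul_of_nonneg_left hd (by positivity)).trans ?_
    -- `Lc^4 · cV θ₁^(j+n+2) ρ^(n+1) ≤ (A/Θ)·Θ^(j+1+(n+1)+1)`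
    rw [show j + 1 + (n + 1) + 1 = (j + n + 1 + 1) + 1 by omega, hkey]
    have hρn : ρ ^ (n + 1) ≤ 1 := pow_le_one₀ hρ0 hρ1.le
    have hθn : θ₁ ^ (j + n + 1 + 1) ≤ Θ ^ (j + n + 1 + 1) := pow_le_pow_left₀ hθ₁0 hθ₁Θ _
    have hΘn : 0 ≤ Θ ^ (j + n + 1 + 1) := pow_nonneg hΘ0.le _
    calc (Lc : ℝ) ^ (3 + 1) * (cV * θ₁ ^ (j + n + 1 + 1) * ρ ^ (n + 1))
        ≤ (Lc : ℝ) ^ (3 + 1) * (cV * Θ ^ (j + n + 1 + 1) * 1) := by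
          refine mul_le_mul_of_nonneg_left ?_ (by positivity)
          exact mul_le_mul (mul_le_mul_of_nonneg_left hθn hcV) hρn (pow_nonneg hρ0 _) (mul_nonneg hcV hΘn)
      _ ≤ A * Θ ^ (j + n + 1 + 1) := by
          rw [hA, mul_one, ← mul_assoc]
          refine mul_le_mul_of_nonneg_right (mul_le_mul_of_nonneg_left ?_ (by positivity)) hΘn
          linarith [le_max_right cVt 0]
  · -- length 1: `k = j + 1 + 1`, both members by `lineage_v_top_pin_apply`, the pair = `Lc^4 ×` the rooted row dVt at `j`
    obtain rfl : k = j + 1 + 1 := by omega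
    rw [show j + 1 + 1 - (j + 1) = 1 by omega,
      lineage_v_top_pin_apply hLc1 hrr hcE cVH (j + 1) κ u x z a b, lineage_v_top_pin_apply hLc1 hrr hcE cVH j κ u x z a b, ← mul_sub,
      abs_mul, abs_of_nonneg (by positivity : (0 : ℝ) ≤ (Lc : ℝ) ^ (3 + 1))]
    have hd := hdVt rr hrr j κ u x z a b
    refine (mul_le_mul_of_nonneg_left hd (by positivity)).trans ?_
    -- `Lc^4 · cVt θ₂^(j+1) ≤ (A/Θ)·Θ^(j+1+1)`
    rw [hkey]
    have hθn : θ₂ ^ (j + 1) ≤ Θ ^ (j + 1) := pow_le_pow_left₀ hθ₂0 hθ₂Θ _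
    have hΘn : 0 ≤ Θ ^ (j + 1) := pow_nonneg hΘ0.le _
    calc (Lc : ℝ) ^ (3 + 1) * (cVt * θ₂ ^ (j + 1)) ≤ (Lc : ℝ) ^ (3 + 1) * (max cVt 0 * Θ ^ (j + 1)) := by
          refine mul_le_mul_of_nonneg_left ?_ (by positivity)
          calc cVt * θ₂ ^ (j + 1) ≤ max cVt 0 * θ₂ ^ (j + 1) := mul_le_mul_of_nonneg_right (le_max_left _ _) (pow_nonneg hθ₂0 _)
            _ ≤ max cVt 0 * Θ ^ (j + 1) := mul_le_mul_of_nonneg_left hθn (le_max_right _ _)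
      _ ≤ A * Θ ^ (j + 1) := by
          rw [hA, ← mul_assoc]
          refine mul_le_mul_of_nonneg_right (mul_le_mul_of_nonneg_left ?_ (by positivity)) hΘn
          linarith

end Summit.QuantumFields.BalabanUV.Beta.GAN24.BornBorderUndressedDriftAn1

end
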